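import Summits.HodgeConjecture.HodgeConjecture.Theorems.MarkmanPartnerTransportPartnerTransportTranscendental
import Summits.HodgeConjecture.HodgeConjecture.Theorems.MarkmanPartnerTransportPartnerTransportIsometry
import Literature.AlgebraicGeometry.Surfaces.K3TranscendentalHodgeIsometryAlgebraic
import Literature.AlgebraicGeometry.Surfaces.GeometricGenusOneAssociatedK3Surface
import Literature.AlgebraicGeometry.HodgeTheory.ComplexOrientationFamily

/-!
# Route MarkmanPartnerTransport · support #3 `IsometrySpannedThird` (stmt-HodgeConjecture-19651) at
# Picard rank `≥ 4` — transporting «`End_Hdg T(X)` is spanned by Hodge isometries» to the CYCLE-INDUCED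
# SECTOR CLAUSE of the K3 partner

For the partner data (marked `(X, φ, P, z)`; marked projective K3 `(S, η, p, x)`; the marked Hilbert square
`(H, φ_H, P_H, (x,0))` with Beauville's algebraic incidence `θ` for the complex orientations; `g` with
(g1), (g2), (g5)): if every rational Hodge endomorphism of `H²(X)` killing `N¹(X)` with `q`-transcendental
image is, on `T(X)`, a `ℚ`-combination of bijective rational Hodge `q`-isometries of `H²(X)` (the route's
`SpannedByIsometries X φ`), then every rational Hodge endomorphism `f_S` of `H²(S)` killing `N¹(S)` with
transcendental image agrees on `T(S)` with `[γ]_*` for an ALGEBRAIC `γ` on `S × S`: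

`f_S ↦ f_X = e [θ]_* f_S π e⁻¹ = Σ cⱼ gⱼ` on `T(X)`; each `uⱼ = π e⁻¹ gⱼ e [θ]_*` is a rational Hodge
isometry of `T(S)` onto itself fixing the period line, hence `[γⱼ]_*` on `T(S)` for an algebraic `γⱼ`
(`Huybrechts2019_transcendentalHodgeIsometry_algebraic` = Huybrechts 2019 Cor. 0.4 (i), derived in the
tree from Buskin's Thm. 1.1), and `f_S = Σ cⱼ uⱼ = [Σ cⱼ γⱼ]_*` on `T(S)`.

* `cycleInducedSector_of_partner_of_spannedByIsometries` — the hypothesis `hU` of the tree's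
  `CycleInducedSector.hodgeConjectureFor_square_of_cycleInducedSector` for the partner `S`, from
  `SpannedByIsometries X φ` (modulo `Huybrechts2019_transcendentalHodgeIsometry_algebraic` and
  `Voisin2003_cupProduct_algebraicClasses` as hypotheses).

No definition, no sorry. Prover seat hodge-nonav-19652-p1 (gen 6), `--supports stmt-HodgeConjecture-19651`.

References: E. Markman, Compos. Math. 160 (2024) Thm. 1.1; D. Huybrechts, Comment. Math. Helv. 94 (2019)
Cor. 0.4; N. Buskin, J. reine angew. Math. 755 (2019) Thm. 1.1; Yu. Zarhin, J. reine angew. Math. 341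
(1983) Thm. 1.5.1; A. Beauville, J. Differential Geom. 18 (1983) §6, §9.
-/

noncomputable section

set_option linter.dupNamespace false

open scoped Matrix
open Module CategoryTheory MonoidalCategory
open Literature.AlgebraicTopology.SingularHomology Literature.Geometry.Kaehler
open Literature.AlgebraicGeometry Literature.AlgebraicGeometry.Motives Literature.AlgebraicGeometry.HodgeTheory
open Literature.AlgebraicGeometry.Hyperkaehler Literature.AlgebraicGeometry.Surfaces
open Summit.HodgeConjecture.HodgeConjecture.Theorems.NikulinTwinTransport
open Summit.HodgeConjecture.HodgeConjecture.Theorems.MarkmanPartnerTransport.BBFPositivity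

namespace Summit.HodgeConjecture.HodgeConjecture.Theorems.MarkmanPartnerTransport.PartnerLattice

/-- `MarkedK3Sq[X, φ, P, z]`: VERBATIM the `let MarkedK3Sq := …` binder of the route declarations of
MarkmanPartnerTransport (clauses (m1)–(m6)). Local notation only. -/
local notation3 (prettyPrint := false) "MarkedK3Sq[" X ", " φ ", " P ", " z "]" =>
  (((IsIntegralClass P ∧ ∀ Q : complexBetti X (2 * 4), IsIntegralClass Q → ∃ n : ℤ, Q = n • P) ∧
    (∀ c : complexBetti X 2, IsIntegralClass c ↔ ∃ v : K3HilbertIndex → ℤ, φ c = fun i => (v i : ℂ)) ∧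
    (∀ a : complexBetti X 2, cupPowTwo a 4 = ((3 : ℂ) * (k3HilbertForm 2 (φ a) (φ a)) ^ 2) • P) ∧
    (IsOfHodgeType 4 X 2 2 0 (LinearEquiv.symm φ z) ∧
      ∀ τ : complexBetti X 2, IsOfHodgeType 4 X 2 2 0 τ → ∃ t : ℂ, τ = t • LinearEquiv.symm φ z) ∧
    (∀ c : complexBetti X 2, IsOfHodgeType 4 X 2 1 1 c ↔
      (k3HilbertForm 2 (φ c) z = 0 ∧ k3HilbertForm 2 (φ c) (star z) = 0)) ∧
    (k3HilbertForm 2 z z = 0 ∧ 0 < (k3HilbertForm 2 (star z) z).re)))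

/-- `MarkedK3P[S, η, p, x]`: VERBATIM the `let MarkedK3 := …` binder of the route declarations (marked
projective K3 surface: `p ≠ 0`, the six marking clauses, the projective period clauses). Local notation only. -/
local notation3 (prettyPrint := false) "MarkedK3P[" S ", " η ", " p ", " x "]" =>
  (p ≠ 0 ∧ (IsIntegralClass p ∧ (∀ q : complexBetti S (2 * 2), IsIntegralClass q → ∃ n : ℤ, q = n • p) ∧
    (∀ c : complexBetti S (2 * 1), IsIntegralClass c ↔ ∃ v : K3Index → ℤ, η c = fun i => (v i : ℂ)) ∧
    (∀ a b : complexBetti S (2 * 1), cupProduct (rfl : 2 * 1 + 2 * 1 = 2 * 2) a b = k3Form (η a) (η b) • p) ∧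
    IsOfHodgeType 2 S (2 * 1) 2 0 (LinearEquiv.symm η x) ∧
    (∀ τ : complexBetti S (2 * 1), IsOfHodgeType 2 S (2 * 1) 2 0 τ → ∃ t : ℂ, τ = t • LinearEquiv.symm η x)) ∧
    (k3Form x x = 0 ∧ 0 < (k3Form (star x) x).re ∧ ∃ u : K3Index → ℤ,
      k3Form (fun i => (u i : ℂ)) x = 0 ∧ 0 < ∑ i, ∑ j, u i * k3Gram i j * u j))

/-- `Corr[hS ; γ, y] = pr₁_*(pr₂^* y ∪ γ)` on `H²(S(ℂ); ℂ)` for the complex orientations. Local notation only. -/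
local notation3 (prettyPrint := false) "Corr[" hS " ; " γ ", " y "]" =>
  complexGysin complexOrientationFamily (IsSmoothProjective.tensor_holds hS hS) hS
    (SemiCartesianMonoidalCategory.fst _ _) (rfl : 2 * 1 + 2 * 2 + 2 * 2 = 2 * 1 + 2 * (2 + 2))
    (cupProduct (rfl : 2 * 1 + 2 * 2 = 2 * 1 + 2 * 2)
      (complexBetti.map (SemiCartesianMonoidalCategory.snd _ _) (2 * 1) y) γ)

variable {X S H : SchemeOver ℂ} {φ : complexBetti X 2 ≃ₗ[ℂ] (K3HilbertIndex → ℂ)} {P : complexBetti X (2 * 4)}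
  {z : K3HilbertIndex → ℂ} {η : complexBetti S (2 * 1) ≃ₗ[ℂ] (K3Index → ℂ)} {p : complexBetti S (2 * 2)}
  {x : K3Index → ℂ} {φH : complexBetti H 2 ≃ₗ[ℂ] (K3HilbertIndex → ℂ)} {PH : complexBetti H (2 * 4)}

/-- **«Spanned by isometries» on `X` ⇒ the cycle-induced sector clause on the K3 partner `S`**
(module docstring), modulo Huybrechts 2019 Cor. 0.4 (i) (a tree consequence of Buskin's Thm. 1.1) and the
multiplicativity of algebraic classes. [cite: Huybrechts2019, Cor. 0.4 (i)] [cite: Buskin2019, Thm. 1.1]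
[cite: Markman2024, §1.1 Thm. 1.1] [cite: Zarhin1983HodgeGroupsK3, Thm. 1.5.1] -/
theorem cycleInducedSector_of_partner_of_spannedByIsometries
    (hHT : Huybrechts2019_transcendentalHodgeIsometry_algebraic)
    (hcup : Voisin2003_cupProduct_algebraicClasses)
    (hX : IsSmoothProjective 4 X) (hM : MarkedK3Sq[X, φ, P, z]) (hS : IsK3Surface S)
    (hMS : MarkedK3P[S, η, p, x])
    (hH : IsSmoothProjective 4 H) (hMH : MarkedK3Sq[H, φH, PH, Sum.elim x 0])
    {θ : complexBetti (H ⊗ S) (2 * 2)} (hθ : θ ∈ algebraicClasses (H ⊗ S) 2)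
    (hi : ∀ a : complexBetti S (2 * 1),
      φH (corrAction complexOrientationFamily hH (IsK3Surface.isSmoothProjective hS)
        (rfl : 2 * 1 + 2 * 2 = 2 + 2 * 2) θ a) = Sum.elim (η a) 0)
    {g : complexBetti S (2 * 1) →ₗ[ℂ] complexBetti X 2}
    (hg1 : ∀ a, IsRationalClass a → IsRationalClass (g a))
    (hg2 : ∀ (i j : ℕ) a, IsOfHodgeType 2 S (2 * 1) i j a → IsOfHodgeType 4 X 2 i j (g a))
    (hg5 : ∀ a b, (∀ d ∈ algebraicClasses S 1, cupProduct (rfl : 2 * 1 + 2 * 1 = 2 * 2) a d = 0) →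
      (∀ d ∈ algebraicClasses S 1, cupProduct (rfl : 2 * 1 + 2 * 1 = 2 * 2) b d = 0) →
      k3HilbertForm 2 (φ (g a)) (φ (g b)) = k3Form (η a) (η b))
    (hSp : ∀ f : complexBetti X 2 →ₗ[ℂ] complexBetti X 2,
      (∀ y, IsRationalClass y → IsRationalClass (f y)) →
      (∀ (i j : ℕ) y, IsOfHodgeType 4 X 2 i j y → IsOfHodgeType 4 X 2 i j (f y)) →
      (∀ d : complexBetti X 2, d ∈ algebraicClasses X 1 → f d = 0) →
      (∀ y : complexBetti X 2, ∀ d : complexBetti X 2, d ∈ algebraicClasses X 1 →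
        k3HilbertForm 2 (φ (f y)) (φ d) = 0) →
      ∃ (k : ℕ) (c : Fin k → ℚ) (gX : Fin k → (complexBetti X 2 →ₗ[ℂ] complexBetti X 2)),
        (∀ i, Function.Bijective (gX i) ∧ (∀ y, IsRationalClass y → IsRationalClass (gX i y)) ∧
          (∀ (a b : ℕ) y, IsOfHodgeType 4 X 2 a b y → IsOfHodgeType 4 X 2 a b (gX i y)) ∧
          (∀ a b, k3HilbertForm 2 (φ (gX i a)) (φ (gX i b)) = k3HilbertForm 2 (φ a) (φ b))) ∧
        ∀ y : complexBetti X 2,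
          (∀ d : complexBetti X 2, d ∈ algebraicClasses X 1 → k3HilbertForm 2 (φ y) (φ d) = 0) →
          f y = ∑ i : Fin k, ((c i : ℂ) • gX i y)) :
    ∀ fS : complexBetti S (2 * 1) →ₗ[ℂ] complexBetti S (2 * 1),
      (∀ y, IsRationalClass y → IsRationalClass (fS y)) →
      (∀ (i j : ℕ) y, IsOfHodgeType 2 S (2 * 1) i j y → IsOfHodgeType 2 S (2 * 1) i j (fS y)) →
      (∀ d ∈ algebraicClasses S 1, fS d = 0) →
      (∀ y : complexBetti S (2 * 1), ∀ d ∈ algebraicClasses S 1,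
        cupProduct (rfl : 2 * 1 + 2 * 1 = 2 * 2) (fS y) d = 0) →
      ∃ gS : complexBetti S (2 * 1) →ₗ[ℂ] complexBetti S (2 * 1),
        (∀ d ∈ algebraicClasses S 1, gS d ∈ algebraicClasses S 1) ∧
        (∃ γ ∈ algebraicClasses (S ⊗ S) 2, ∀ y : complexBetti S (2 * 1),
          gS y = Corr[IsK3Surface.isSmoothProjective hS ; γ, y]) ∧
        ∀ y : complexBetti S (2 * 1),
          (∀ d ∈ algebraicClasses S 1, cupProduct (rfl : 2 * 1 + 2 * 1 = 2 * 2) y d = 0) → fS y = gS y := by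
  classical
  intro fS hr hh hk ht
  obtain ⟨hp0, ⟨hpint, hpgen, hηint, hcupS, h20, h20span⟩, hxx, hxpos, huS⟩ := hMS
  obtain ⟨-, hint, -, ⟨hz20, hz20span⟩, -⟩ := id hM
  obtain ⟨-, hintH, -⟩ := id hMH
  have hS2 : IsSmoothProjective 2 S := IsK3Surface.isSmoothProjective hS
  have hμ := hasPoincareDuality_complexOrientationFamily
  -- transcendental = cup-transcendental
  have hT : ∀ a : complexBetti S (2 * 1), a ∈ transcendentalSubspace S ↔
      ∀ d ∈ algebraicClasses S 1, cupProduct (rfl : 2 * 1 + 2 * 1 = 2 * 2) a d = 0 :=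
    fun a => mem_transcendentalSubspace_iff_forall_algebraicClasses hS2 a
  -- the marked rational Hodge isometry `e : H²(H) ⥲ H²(X)` and its inverse
  obtain ⟨f, hfbij, hfrat, hfh, hfq⟩ := exists_markedHodgeIsometry_of_partner hcup hμ hX hM hS hηint hcupS
    h20 hxpos hH hMH hθ hi hg1 hg2 hg5
  obtain ⟨e, he, herat, heh, heq'⟩ := exists_inverse_markedHodgeIsometry hH hX hMH hM hfbij hfrat hfh hfq
  have herat' : ∀ c, IsRationalClass c → IsRationalClass (e c) := fun c hc => by rw [he]; exact hfrat c hc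
  have heh' : ∀ (i j : ℕ) c, IsOfHodgeType 4 H 2 i j c → IsOfHodgeType 4 X 2 i j (e c) :=
    fun i j c hc => by rw [he]; exact hfh i j c hc
  have heq : ∀ a b, k3HilbertForm 2 (φ (e a)) (φ (e b)) = k3HilbertForm 2 (φH a) (φH b) :=
    fun a b => by rw [he, he]; exact hfq a b
  have hsymmN : ∀ d ∈ algebraicClasses X 1, e.symm d ∈ algebraicClasses H 1 := fun d hd =>
    map_mem_algebraicClasses_of_isRationalClass_of_oneOne hX hH (e.symm : complexBetti X 2 →ₗ[ℂ] complexBetti H 2)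
      herat (heh 1 1) hd
  have heN : ∀ d ∈ algebraicClasses H 1, e d ∈ algebraicClasses X 1 := fun d hd =>
    map_mem_algebraicClasses_of_isRationalClass_of_oneOne hH hX (e : complexBetti H 2 →ₗ[ℂ] complexBetti X 2)
      herat' (heh' 1 1) hd
  -- `i`, `π`
  set i : complexBetti S (2 * 1) →ₗ[ℂ] complexBetti H 2 :=
    corrAction complexOrientationFamily hH hS2 (rfl : 2 * 1 + 2 * 2 = 2 + 2 * 2) θ with hidef
  have hi' : ∀ a, φH (i a) = Sum.elim (η a) 0 := hi
  set π : complexBetti H 2 →ₗ[ℂ] complexBetti S (2 * 1) :=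
    (η.symm : (K3Index → ℂ) →ₗ[ℂ] complexBetti S (2 * 1)) ∘ₗ
      LinearMap.funLeft ℂ ℂ (Sum.inl : K3Index → K3HilbertIndex) ∘ₗ
      (φH : complexBetti H 2 →ₗ[ℂ] (K3HilbertIndex → ℂ)) with hπdef
  have hπ : ∀ w, π w = η.symm (fun k => φH w (Sum.inl k)) := fun w => rfl
  have hπi : ∀ a, π (i a) = a := fun a => by rw [hπ]; exact retraction_incidence hi' a
  -- `T`-bookkeeping: `e ∘ i : T(S) → T(X)`, `T(H) = i(T(S))`, `e⁻¹ : T(X) → T(H)`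
  have hiT : ∀ t, (∀ d ∈ algebraicClasses S 1, cupProduct (rfl : 2 * 1 + 2 * 1 = 2 * 2) t d = 0) →
      ∀ d ∈ algebraicClasses H 1, k3HilbertForm 2 (φH (i t)) (φH d) = 0 :=
    fun t htt => incidence_bbfTransc hS hp0 hηint hcupS h20 hxpos hH hMH hi' htt
  have heT : ∀ w, (∀ d ∈ algebraicClasses H 1, k3HilbertForm 2 (φH w) (φH d) = 0) →
      ∀ d ∈ algebraicClasses X 1, k3HilbertForm 2 (φ (e w)) (φ d) = 0 :=
    fun w hw => bbfTransc_map_of_markedHodgeIsometry hH hX e herat (heh 1 1) heq hw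
  have hsymmT : ∀ y, (∀ d ∈ algebraicClasses X 1, k3HilbertForm 2 (φ y) (φ d) = 0) →
      ∀ d ∈ algebraicClasses H 1, k3HilbertForm 2 (φH (e.symm y)) (φH d) = 0 := by
    intro y hy d hd
    have h1 : k3HilbertForm 2 (φH (e.symm y)) (φH d) = k3HilbertForm 2 (φ (e (e.symm y))) (φ (e d)) := by
      rw [heq]
    rw [h1, LinearEquiv.apply_symm_apply]
    exact hy _ (heN d hd)
  have hTH : ∀ w, (∀ d ∈ algebraicClasses H 1, k3HilbertForm 2 (φH w) (φH d) = 0) →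
      (∀ d ∈ algebraicClasses S 1, cupProduct (rfl : 2 * 1 + 2 * 1 = 2 * 2) (π w) d = 0) ∧ i (π w) = w := by
    intro w hw
    rw [hπ]
    exact exists_incidence_eq_of_bbfTransc hcup hμ hS hcupS hH hMH hθ hi hw
  -- the conjugated endomorphism `fX = e ∘ i ∘ fS ∘ π ∘ e⁻¹`
  set fX : complexBetti X 2 →ₗ[ℂ] complexBetti X 2 :=
    (e : complexBetti H 2 →ₗ[ℂ] complexBetti X 2) ∘ₗ i ∘ₗ fS ∘ₗ π ∘ₗ
      (e.symm : complexBetti X 2 →ₗ[ℂ] complexBetti H 2) with hfXdef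
  have hfX : ∀ c, fX c = e (i (fS (π (e.symm c)))) := fun c => rfl
  have h1 : ∀ c, IsRationalClass c → IsRationalClass (fX c) := by
    intro c hc
    rw [hfX]
    refine herat' _ (isRationalClass_incidence hS hH hηint hintH hi' (hr _ ?_))
    rw [hπ]
    exact isRationalClass_retraction hS hH hηint hintH (herat c hc)
  have h3 : ∀ d : complexBetti X 2, d ∈ algebraicClasses X 1 → fX d = 0 := by
    intro d hd
    rw [hfX, hπ, hk _ (retraction_mem_algebraicClasses hS hp0 hηint hcupS h20 hxpos hH hMH (hsymmN d hd)),
      map_zero, map_zero]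
  have h4 : ∀ y : complexBetti X 2, ∀ d : complexBetti X 2, d ∈ algebraicClasses X 1 →
      k3HilbertForm 2 (φ (fX y)) (φ d) = 0 := by
    intro y d hd
    rw [hfX]
    exact heT _ (hiT _ (ht _)) d hd
  have h20X : ∀ c, IsOfHodgeType 4 X 2 2 0 c → IsOfHodgeType 4 X 2 2 0 (fX c) := by
    intro c hc
    rw [hfX]
    refine heh' 2 0 _ (incidence_twoZero hMH h20span hi' (hh 2 0 _ ?_))
    rw [hπ]
    exact retraction_twoZero hMH h20 (heh 2 0 c hc)
  have h11X : ∀ c, IsOfHodgeType 4 X 2 1 1 c → IsOfHodgeType 4 X 2 1 1 (fX c) := by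
    intro c hc
    rw [hfX]
    refine heh' 1 1 _ (incidence_oneOne hS hp0 hηint hcupS h20 hxpos hMH hi' (hh 1 1 _ ?_))
    rw [hπ]
    exact retraction_oneOne hS hp0 hηint hcupS h20 hxpos hMH (heh 1 1 c hc)
  have hfXconj : ∀ c, fX (conjClass (ComplexPoints X) 2 c) = conjClass (ComplexPoints X) 2 (fX c) :=
    conjClass_map_of_isRationalClass hX hX hint hint fX h1
  have h2 : ∀ (a b : ℕ) c, IsOfHodgeType 4 X 2 a b c → IsOfHodgeType 4 X 2 a b (fX c) := by
    intro a b c hc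
    by_cases hab : a + b = 2
    · have ha2 : a ≤ 2 := by omega
      interval_cases a
      · have hb : b = 2 := by omega
        subst hb
        rw [← conjClass_conjClass (fX c), ← hfXconj]
        exact (h20X _ (hc.conjClass hX)).conjClass hX
      · have hb : b = 1 := by omega
        subst hb
        exact h11X c hc
      · have hb : b = 0 := by omega
        subst hb
        exact h20X c hc
    · have hc0 : c = 0 := by
        obtain ⟨A, hA⟩ := hc
        rw [(A.hodgePQ_eq_bot_iff 2 a b).2
            (Literature.NumberTheory.Transcendental.hodgePQ_eq_bot_of_ne (M := A.carrier) hab),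
          Submodule.mem_bot] at hA
        exact A.pullback_injective 2 (by rw [hA, map_zero])
      rw [hc0, map_zero]
      exact isOfHodgeType_zero_of_isSmoothProjective nonempty_hodgeModel_holds hX 2 a b
  -- «spanned by isometries» on `X`
  obtain ⟨k, c, gX, hgX, hsum⟩ := hSp fX h1 h2 h3 h4
  -- the pulled-back isometries `u j = π e⁻¹ gⱼ e i` of `T(S)`
  have hgT : ∀ j, ∀ y, (∀ d ∈ algebraicClasses X 1, k3HilbertForm 2 (φ y) (φ d) = 0) →
      (∀ d ∈ algebraicClasses X 1, k3HilbertForm 2 (φ (gX j y)) (φ d) = 0) ∧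
      ∃ y', (∀ d ∈ algebraicClasses X 1, k3HilbertForm 2 (φ y') (φ d) = 0) ∧ gX j y' = y := by
    intro j y hy
    obtain ⟨hbij, hrat, hhodge, hiso⟩ := hgX j
    obtain ⟨ej, hej, hejrat, hejh, hejq⟩ := exists_inverse_markedHodgeIsometry hX hX hM hM hbij hrat hhodge hiso
    have hejN : ∀ d ∈ algebraicClasses X 1, ej.symm d ∈ algebraicClasses X 1 := fun d hd =>
      map_mem_algebraicClasses_of_isRationalClass_of_oneOne hX hX (ej.symm : complexBetti X 2 →ₗ[ℂ] complexBetti X 2)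
        hejrat (hejh 1 1) hd
    refine ⟨fun d hd => ?_, ⟨ej.symm y, ?_, ?_⟩⟩
    · have h1' : k3HilbertForm 2 (φ (gX j y)) (φ d) = k3HilbertForm 2 (φ (gX j y)) (φ (gX j (ej.symm d))) := by
        rw [← hej (ej.symm d), LinearEquiv.apply_symm_apply]
      rw [h1', hiso]
      exact hy _ (hejN d hd)
    · exact bbfTransc_symm_of_markedHodgeIsometry hX ej (fun c hc => by rw [hej]; exact hrat c hc)
        (fun c hc => by rw [hej]; exact hhodge 1 1 c hc) hejq hy
    · rw [← hej (ej.symm y), LinearEquiv.apply_symm_apply]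
  set u : Fin k → (complexBetti S (2 * 1) →ₗ[ℂ] complexBetti S (2 * 1)) := fun j =>
    π ∘ₗ (e.symm : complexBetti X 2 →ₗ[ℂ] complexBetti H 2) ∘ₗ gX j ∘ₗ
      (e : complexBetti H 2 →ₗ[ℂ] complexBetti X 2) ∘ₗ i with hudef
  have hu : ∀ j a, u j a = π (e.symm (gX j (e (i a)))) := fun j a => rfl
  -- on `T(S)`: `e (i (u j t)) = gX j (e (i t))`, and `u j t ∈ T(S)`
  have hkey : ∀ j t, (∀ d ∈ algebraicClasses S 1, cupProduct (rfl : 2 * 1 + 2 * 1 = 2 * 2) t d = 0) →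
      (∀ d ∈ algebraicClasses S 1, cupProduct (rfl : 2 * 1 + 2 * 1 = 2 * 2) (u j t) d = 0) ∧
      e (i (u j t)) = gX j (e (i t)) := by
    intro j t htt
    have hw : ∀ d ∈ algebraicClasses H 1, k3HilbertForm 2 (φH (e.symm (gX j (e (i t))))) (φH d) = 0 :=
      hsymmT _ ((hgT j _ (heT _ (hiT t htt))).1)
    obtain ⟨hπT, hiπ⟩ := hTH _ hw
    refine ⟨by rw [hu]; exact hπT, ?_⟩
    rw [hu, hiπ, LinearEquiv.apply_symm_apply]
  -- each `u j` is a rational Hodge isometry of `T(S)` onto itself fixing the period line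
  have huγ : ∀ j, ∃ γ ∈ algebraicClasses (S ⊗ S) 2, ∀ y ∈ transcendentalSubspace S,
      u j y = Corr[hS.1 ; γ, y] := by
    intro j
    obtain ⟨hbij, hrat, hhodge, hiso⟩ := hgX j
    refine hHT hS hS η p x η p x ⟨hp0, ⟨hpint, hpgen, hηint, hcupS, h20, h20span⟩, hxx, hxpos, huS⟩
      ⟨hp0, ⟨hpint, hpgen, hηint, hcupS, h20, h20span⟩, hxx, hxpos, huS⟩ (u j) ?_ ?_ ?_ ?_ ?_
    · -- `T → T`
      intro y hy
      exact (hT _).2 (hkey j y ((hT y).1 hy)).1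
    · -- onto `T`
      intro w hw
      have hwT := (hT w).1 hw
      obtain ⟨-, y', hy'T, hy'⟩ := hgT j _ (heT _ (hiT w hwT))
      obtain ⟨hπT, hiπ⟩ := hTH _ (hsymmT _ hy'T)
      refine ⟨π (e.symm y'), (hT _).2 hπT, ?_⟩
      rw [hu, hiπ, LinearEquiv.apply_symm_apply, hy', LinearEquiv.symm_apply_apply, hπi]
    · -- rational on `T`
      intro y _ hy
      rw [hu, hπ]
      exact isRationalClass_retraction hS hH hηint hintH
        (herat _ (hrat _ (herat' _ (isRationalClass_incidence hS hH hηint hintH hi' hy))))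
    · -- isometric on `T`
      intro a ha b hb
      have haT := (hT a).1 ha
      have hbT := (hT b).1 hb
      have key : ∀ s t, e (i s) = gX j (e (i t)) → ∀ s' t', e (i s') = gX j (e (i t')) →
          k3Form (η s) (η s') = k3Form (η t) (η t') := by
        intro s t hs s' t' hs'
        rw [← k3HilbertForm_inl, ← k3HilbertForm_inl, ← hi' s, ← hi' s', ← hi' t, ← hi' t', ← heq, ← heq,
          hs, hs', hiso, heq]
      exact key _ _ (hkey j a haT).2 _ _ (hkey j b hbT).2
    · -- the period line
      have h20u : IsOfHodgeType 2 S (2 * 1) 2 0 (u j (η.symm x)) := by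
        rw [hu, hπ]
        exact retraction_twoZero hMH h20 (heh 2 0 _ (hhodge 2 0 _ (heh' 2 0 _
          (incidence_twoZero hMH h20span hi' h20))))
      exact h20span _ h20u
  choose γ hγalg hγ using huγ
  -- the algebraic class `Σ cⱼ γⱼ` and the endomorphism it induces
  set Γ : complexBetti (S ⊗ S) (2 * 2) := ∑ j, (c j : ℂ) • γ j with hΓdef
  have hΓalg : Γ ∈ algebraicClasses (S ⊗ S) 2 :=
    Submodule.sum_mem _ fun j _ => Submodule.smul_mem _ _ (hγalg j)
  set gS : complexBetti S (2 * 1) →ₗ[ℂ] complexBetti S (2 * 1) :=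
    corrAction complexOrientationFamily hS2 hS2 (rfl : 2 * 1 + 2 * 2 = 2 * 1 + 2 * 2) Γ with hgSdef
  have hgS : ∀ y, gS y = Corr[hS.1 ; Γ, y] := fun y => rfl
  have hgSsum : ∀ y, gS y = ∑ j, (c j : ℂ) • Corr[hS.1 ; γ j, y] := by
    intro y
    rw [hgSdef, hΓdef, map_sum, LinearMap.sum_apply]
    refine Finset.sum_congr rfl fun j _ => ?_
    rw [map_smul, LinearMap.smul_apply]
    rfl
  refine ⟨gS, fun d hd => ?_, ⟨Γ, hΓalg, hgS⟩, fun y hy => ?_⟩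
  · exact corrAction_mem_algebraicClasses_of_cupProductFact hcup hμ hS2 hS2 (q := 1) rfl (by norm_num) hΓalg hd
  · -- `fS y = Σ cⱼ uⱼ y = Σ cⱼ [γⱼ]_* y = [Γ]_* y` on `T(S)`
    have hyT : y ∈ transcendentalSubspace S := (hT y).2 hy
    have h1' : e (i (fS y)) = ∑ j, (c j : ℂ) • gX j (e (i y)) := by
      have h := hsum (e (i y)) (heT _ (hiT y hy))
      rw [hfX, LinearEquiv.symm_apply_apply, hπi] at h
      exact h
    have h2' : e (i (fS y)) = e (i (∑ j, (c j : ℂ) • u j y)) := by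
      rw [h1', map_sum, map_sum]
      refine Finset.sum_congr rfl fun j _ => ?_
      rw [map_smul, map_smul, (hkey j y hy).2]
    have h3' : fS y = ∑ j, (c j : ℂ) • u j y := incidence_injective hi' (e.injective h2')
    rw [h3', hgSsum]
    exact Finset.sum_congr rfl fun j _ => by rw [hγ j y hyT]

end Summit.HodgeConjecture.HodgeConjecture.Theorems.MarkmanPartnerTransport.PartnerLattice

end
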